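import Mathlib
import Summits.Ventures.PercRepro2.A3PendantOFibres
import Summits.Ventures.PercRepro2.A3BetweenDZero
import Summits.Ventures.PercRepro2.A3PendantRoot

/-!
# (MEANS-a₃) holds whenever every edge at `a₃` is a root edge (blind cell PercRepro2, night-1 g30;
proofs/NIGHT1-G30.md §5 — the «root-only» class of the reduced statement)

If every edge incident to `a₃` joins it to `a₁` or to `a₂` (any number of such edges), then by p5's
root-edge closure (`RootEdge.A3Between_of_noRootEdge_class'`, A3BetweenDZero.lean) (MEANS-a₃) at `p`
follows from (MEANS-a₃) at the weight vectors in which every edge at `a₃` has weight `0` — where `a₃`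
is weight-inactive: every configuration with `C(a₃) ≠ {a₃}` has an open edge at `a₃` of weight `0`, so
every fibre other than `{a₃}` is null (`mW_eq_zero_of_edges_zero`), `m_{a₃} = P(Q) = D`
(`mW_singleton_of_edges_zero`, `prob_PD_of_edges_zero`), and the between-term vanishes
(`btw_eq_zero_of_null_off_singleton`): **`A3Between_of_edges_zero`**, hence **`A3Between_rootOnly`**.
It subsumes `A3Between_pendant_root` (one root edge).  Standard axioms.
-/

namespace Summit.Ventures.PercRepro2

open UnionCluster CovForm

namespace CovForm

namespace A3Fibre

section Inactive

variable {V : Type*} {E : Type*} [Fintype V] [DecidableEq V] [Fintype E] [DecidableEq E]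
  {R : Type*} [Field R] [LinearOrder R] [IsStrictOrderedRing R] {ends : E → Sym2 V} {a₃ : V}

omit [Fintype V] [DecidableEq V] [Fintype E] [DecidableEq E] in
/-- With every edge at `a₃` closed, the cluster of `a₃` is `{a₃}`. -/
lemma cluster_eq_singleton_of_closed_at {ω : Config E} (h : ∀ e, a₃ ∈ ends e → ω e = false) :
    cluster ends ω a₃ = ({a₃} : Set V) := by
  ext u
  simp only [cluster, Set.mem_setOf_eq, Set.mem_singleton_iff]
  constructor
  · intro hc
    have hS : ∀ x ∈ ({a₃} : Set V), ∀ y, (openGraph ends ω).Adj x y → y ∈ ({a₃} : Set V) := by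
      intro x hx y hxy
      rw [Set.mem_singleton_iff] at hx
      rw [hx, openGraph_adj] at hxy
      obtain ⟨e, he, hends⟩ := hxy.2
      have : a₃ ∈ ends e := by rw [hends]; exact Sym2.mem_mk_left _ _
      rw [h e this] at he
      exact absurd he Bool.false_ne_true
    exact (mem_of_conn_of_closed hS (Set.mem_singleton a₃) hc)
  · intro hu; rw [hu]; exact conn_refl ends ω a₃

omit [Fintype V] [DecidableEq V] [DecidableEq E] [LinearOrder R] [IsStrictOrderedRing R] in
/-- A configuration with an open edge of weight `0` has weight `0`. -/
lemma weight_eq_zero_of_open_zero (p : E → R) {ω : Config E} {e : E} (hp0 : p e = 0)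
    (hω : ω e = true) : weight p ω = 0 := by
  unfold weight
  apply Finset.prod_eq_zero (Finset.mem_univ e)
  rw [hω, hp0]
  simp [edgeFactor]

omit [Fintype V] [DecidableEq V] [LinearOrder R] [IsStrictOrderedRing R] in
/-- An event all of whose configurations have weight `0` has probability `0`. -/
lemma prob_eq_zero_of_weight_eq_zero (p : E → R) {A : Set (Config E)}
    (h : ∀ ω ∈ A, weight p ω = 0) : prob p A = 0 := by
  unfold prob
  apply Finset.sum_eq_zero
  intro ω _
  by_cases hω : ω ∈ A
  · rw [Set.indicator_of_mem hω, h ω hω]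
  · rw [Set.indicator_of_notMem hω]

omit [Fintype V] [DecidableEq V] [IsStrictOrderedRing R] in
/-- When every edge at `a₃` has weight `0`, every event inside `{C(a₃) ≠ {a₃}}` is null. -/
lemma prob_eq_zero_of_edges_zero (p : E → R) (h : ∀ e, a₃ ∈ ends e → p e = 0)
    {A : Set (Config E)} (hA : ∀ ω ∈ A, cluster ends ω a₃ ≠ ({a₃} : Set V)) : prob p A = 0 := by
  apply prob_eq_zero_of_weight_eq_zero
  intro ω hω
  by_contra hw
  apply hA ω hω
  apply cluster_eq_singleton_of_closed_at
  intro e he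
  by_contra hopen
  have hopen' : ω e = true := by cases h' : ω e <;> simp_all
  exact hw (weight_eq_zero_of_open_zero p (h e he) hopen')

omit [Fintype V] [DecidableEq V] [IsStrictOrderedRing R] in
/-- When every edge at `a₃` has weight `0`, every fibre other than `{a₃}` is null. -/
lemma mW_eq_zero_of_edges_zero (p : E → R) (h : ∀ e, a₃ ∈ ends e → p e = 0) (a₁ a₂ : V)
    {W : Finset V} (hW : W ≠ {a₃}) : mW p ends a₁ a₂ a₃ W = 0 := by
  unfold mW
  apply prob_eq_zero_of_edges_zero p h
  intro ω hω hc
  apply hW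
  apply Finset.coe_injective
  rw [← hω.2, hc, Finset.coe_singleton]

omit [Fintype V] [DecidableEq V] in
/-- When every edge at `a₃` has weight `0`, `m_{a₃} = P(Q)`. -/
lemma mW_singleton_of_edges_zero (p : E → R) (h : ∀ e, a₃ ∈ ends e → p e = 0) (a₁ a₂ : V) :
    mW p ends a₁ a₂ a₃ {a₃} = prob p (avoidAll ends a₂ {a₁}) := by
  have hsplit := prob_inter_add_prob_inter_compl p (avoidAll ends a₂ {a₁})
    (clusterEvent ends a₃ (↑({a₃} : Finset V) : Set V))
  have hz : prob p (avoidAll ends a₂ {a₁} ∩ (clusterEvent ends a₃ (↑({a₃} : Finset V) : Set V))ᶜ) = 0 := by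
    apply prob_eq_zero_of_edges_zero p h
    intro ω hω hc
    apply hω.2
    rw [mem_clusterEvent, hc, Finset.coe_singleton]
  unfold mW fibre
  linarith

omit [Fintype V] [DecidableEq V] in
/-- When every edge at `a₃` has weight `0`, `D = P(Q)` (`a₃ ∉ {a₁, a₂}`). -/
lemma prob_PD_of_edges_zero (p : E → R) (h : ∀ e, a₃ ∈ ends e → p e = 0) {a₁ a₂ : V}
    (h31 : a₃ ≠ a₁) (h32 : a₃ ≠ a₂) :
    prob p (PDEvent ends a₁ a₂ a₃) = prob p (avoidAll ends a₂ {a₁}) := by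
  have hsplit := prob_inter_add_prob_inter_compl p (avoidAll ends a₂ {a₁}) (Dtilde ends a₁ a₂ a₃)
  have hz : prob p (avoidAll ends a₂ {a₁} ∩ (Dtilde ends a₁ a₂ a₃)ᶜ) = 0 := by
    apply prob_eq_zero_of_edges_zero p h
    intro ω hω hc
    apply hω.2
    simp only [Dtilde, Set.mem_compl_iff]
    intro hin
    rcases hin with hconn | hconn
    · have : a₁ ∈ cluster ends ω a₃ := hconn
      rw [hc, Set.mem_singleton_iff] at this
      exact h31 this.symm
    · have : a₂ ∈ cluster ends ω a₃ := hconn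
      rw [hc, Set.mem_singleton_iff] at this
      exact h32 this.symm
  have e : PDEvent ends a₁ a₂ a₃ = avoidAll ends a₂ {a₁} ∩ Dtilde ends a₁ a₂ a₃ := by
    rw [PDEvent, avoidAll_eq_compl']
  rw [e]
  linarith

end Inactive


section RootOnly

variable {V : Type*} {E : Type*} [Fintype V] [DecidableEq V] [Fintype E] [DecidableEq E]
  {R : Type*} [Field R] [LinearOrder R] [IsStrictOrderedRing R] {ends : E → Sym2 V} {a₃ : V}

/-- **(MEANS-a₃) when every edge at `a₃` has weight `0`** (`a₃` weight-inactive). -/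
theorem A3Between_of_edges_zero {p : E → R} (hp : IsProbVec p) (h : ∀ e, a₃ ∈ ends e → p e = 0)
    {o a₁ a₂ b : V} (h31 : a₃ ≠ a₁) (h32 : a₃ ≠ a₂) : A3Between p ends o a₁ a₂ a₃ b := by
  unfold A3Between
  rw [btw_eq_zero_of_null_off_singleton hp ends o a₁ a₂ a₃ b
    (fun W hW => mW_eq_zero_of_edges_zero p h a₁ a₂ hW) (mW_singleton_of_edges_zero p h a₁ a₂)
    (prob_PD_of_edges_zero p h h31 h32) h31 h32]

/-- **(MEANS-a₃) whenever every edge at `a₃` is a root edge** (any number of them): p5's root-edge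
closure reduces the class to the weight-inactive `a₃`. -/
theorem A3Between_rootOnly {p : E → R} (hp : IsProbVec p) {o a₁ a₂ b : V}
    (h : ∀ e, a₃ ∈ ends e → RootEdge.IsRootEdge ends a₁ a₂ a₃ e) (h31 : a₃ ≠ a₁) (h32 : a₃ ≠ a₂) :
    A3Between p ends o a₁ a₂ a₃ b := by
  refine RootEdge.A3Between_of_noRootEdge_class' p hp ends o a₁ a₂ a₃ b fun p' hp' hn => ?_
  exact A3Between_of_edges_zero hp' (fun e he => hn e (h e he)) h31 h32

end RootOnly

end A3Fibre

end CovForm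

end Summit.Ventures.PercRepro2
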